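import Literature.Analysis.FunctionSpaces.PolchinskiSmoothedJets
import Literature.Analysis.FunctionSpaces.PolchinskiExchangeJets
import HarnessLib

/-!
# The pointwise exchange inequality for `(∇√P_{0,t}F)²_{Ċ_t}` with TAME jets (Bauerschmidt–Bodineau–
# Dagallier, Lemma 1 + (e:assCt-mon)), for initial Boltzmann weights of the smoothed class

Topic `Literature/Analysis/FunctionSpaces`; "proof architecture" file behind the named fact
`Polchinski.BauerschmidtBodineau_multiscaleBakryEmery` ([BBD] Theorem 3, `MultiscaleBakryEmery.lean`).

`PolchinskiExchangeJets.sqrtGradient_exchange` packages, for `V₀ ∈ C_b⁴`, the `C_b²` data of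
`H = (∇√u)²_{Ċ}` (`u = W/Z = P_{0,t}F`) and the pointwise inequality
`2λ̇ H ≤ (½Σ Ċ^{ij}∂_i∂_jH − Σ Ċ^{ij}∂_iV_t ∂_jH) − Ḣ` ([BBD] Lemma 1 with the multiscale condition),
using a positive lower bound `Z ≥ m`.  This file is the same statement WITHOUT a lower bound on `Z`
(the smoothed class of `e^{−V_s}` when `V₀` is only bounded below): the atoms carry jet packs relative to
the weight `Z` (`PolchinskiSmoothedJets.lean`), `u, ∂_k u, (∇u)²_Ċ, H` carry tame packs, and in
addition — for the uniform continuity of the second derivative of the weighted family `Z·H`, which is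
obtained from third-order data — each partial `∂_jH` is exhibited as a function with its own tame pack
(`∂_jH = ∂_jA/(4u) − A ∂_ju/(4u²)`, `∂_jA = Σ Ċ^{kl}(g_k ∂_jg_l + g_l ∂_jg_k)`,
`∂_jg_l = W_{lj}/Z − W_lZ_j/Z² − W_jZ_l/Z² − WZ_{lj}/Z² + 2WZ_lZ_j/Z³`).  The pointwise Bochner
algebra (`bochner_sqrt_ineq`, `jet_generator`, `jet_gradient_generator`) is reused verbatim.

## Main result (sorry-free; no new definitions, no new named facts)

* **`sqrtGradient_texchange`** — tame pack of `H = (∇√(W/Z))²_{Ċ}`, tame packs of its partials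
  `∂_jH` with `DH·e_j = ∂_jH`, and the pointwise inequality `2λ̇H ≤ L_tH − Ḣ` of [BBD] Lemma 1.

Nothing here concerns Yang–Mills.

## References

* [BauerschmidtBodineauDagallier2023] R. Bauerschmidt, T. Bodineau, B. Dagallier, Probab. Surveys 21
  (2024) 200–290, arXiv:2307.07619 — Lemma 1 p0016 L115–p0017, Theorem 3 proof p0016 L130–153. READ
  (held text `paper:arxiv-2307.07619`).
-/

noncomputable section

-- nested operator-norm instances `E →L[ℝ] E →L[ℝ] ℝ`
set_option maxSynthPendingDepth 3

open Filter Topology Set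
open scoped Matrix

namespace Literature.Analysis.FunctionSpaces

namespace Polchinski

variable {N : ℕ}

section Jets

variable {Z W : EuclideanSpace ℝ (Fin N) → ℝ} {K₀ : ℝ}
  {DZ DW : EuclideanSpace ℝ (Fin N) → EuclideanSpace ℝ (Fin N) →L[ℝ] ℝ}
  {D2Z D2W : EuclideanSpace ℝ (Fin N) → EuclideanSpace ℝ (Fin N) →L[ℝ] EuclideanSpace ℝ (Fin N) →L[ℝ] ℝ}

set_option maxHeartbeats 2000000 in
/-- **The exchange inequality for `H = (∇√u)²_{Ċ}`, `u = W/Z`, with tame jets** ([BBD] Lemma 1, p0016 L115 –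
p0017, combined with the multiscale condition (e:assCt-mon), p0016 L150–153), for atoms `Z > 0`, `W ≥ aZ`,
`Z₁ₖ, W₁ₖ, Z₁ₖⱼ, W₁ₖⱼ` carrying jet packs relative to `Z` (no lower bound on `Z`).  Conclusion: a tame pack
for `H`, tame packs for the partials `∂_jH` (with `DH·e_j = ∂_jH`), and at every point
`2λ H ≤ (½Σ Ċ^{ij}∂_i∂_jH − Σ Ċ^{ij}(−Z₁ᵢ/Z)∂_jH) − Ḣ`. [cite: BauerschmidtBodineauDagallier2023, Lemma 1] -/
theorem sqrtGradient_texchange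
    (hZ : ∀ x, 0 < Z x) (hZK : ∀ x, Z x ≤ K₀)
    (pZ : (∀ x, HasFDerivAt Z (DZ x) x) ∧ (∀ x, HasFDerivAt DZ (D2Z x) x) ∧
      (∀ δ : ℝ, 0 < δ → ∃ c : ℝ, 0 ≤ c ∧ ∀ x, |Z x| ≤ c * Z x ^ (1 - δ)) ∧
      (∀ δ : ℝ, 0 < δ → ∃ c : ℝ, 0 ≤ c ∧ ∀ x, ‖DZ x‖ ≤ c * Z x ^ (1 - δ)) ∧
      (∀ δ : ℝ, 0 < δ → ∃ c : ℝ, 0 ≤ c ∧ ∀ x, ‖D2Z x‖ ≤ c * Z x ^ (1 - δ)))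
    (pW : (∀ x, HasFDerivAt W (DW x) x) ∧ (∀ x, HasFDerivAt DW (D2W x) x) ∧
      (∀ δ : ℝ, 0 < δ → ∃ c : ℝ, 0 ≤ c ∧ ∀ x, |W x| ≤ c * Z x ^ (1 - δ)) ∧
      (∀ δ : ℝ, 0 < δ → ∃ c : ℝ, 0 ≤ c ∧ ∀ x, ‖DW x‖ ≤ c * Z x ^ (1 - δ)) ∧
      (∀ δ : ℝ, 0 < δ → ∃ c : ℝ, 0 ≤ c ∧ ∀ x, ‖D2W x‖ ≤ c * Z x ^ (1 - δ)))
    {Z1 W1 : Fin N → EuclideanSpace ℝ (Fin N) → ℝ}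
    {DZ1 DW1 : Fin N → EuclideanSpace ℝ (Fin N) → EuclideanSpace ℝ (Fin N) →L[ℝ] ℝ}
    {D2Z1 D2W1 : Fin N → EuclideanSpace ℝ (Fin N) →
      EuclideanSpace ℝ (Fin N) →L[ℝ] EuclideanSpace ℝ (Fin N) →L[ℝ] ℝ}
    (pZ1 : ∀ k, (∀ x, HasFDerivAt (Z1 k) ((DZ1 k) x) x) ∧ (∀ x, HasFDerivAt (DZ1 k) ((D2Z1 k) x) x) ∧
      (∀ δ : ℝ, 0 < δ → ∃ c : ℝ, 0 ≤ c ∧ ∀ x, |(Z1 k) x| ≤ c * Z x ^ (1 - δ)) ∧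
      (∀ δ : ℝ, 0 < δ → ∃ c : ℝ, 0 ≤ c ∧ ∀ x, ‖(DZ1 k) x‖ ≤ c * Z x ^ (1 - δ)) ∧
      (∀ δ : ℝ, 0 < δ → ∃ c : ℝ, 0 ≤ c ∧ ∀ x, ‖(D2Z1 k) x‖ ≤ c * Z x ^ (1 - δ)))
    (pW1 : ∀ k, (∀ x, HasFDerivAt (W1 k) ((DW1 k) x) x) ∧ (∀ x, HasFDerivAt (DW1 k) ((D2W1 k) x) x) ∧
      (∀ δ : ℝ, 0 < δ → ∃ c : ℝ, 0 ≤ c ∧ ∀ x, |(W1 k) x| ≤ c * Z x ^ (1 - δ)) ∧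
      (∀ δ : ℝ, 0 < δ → ∃ c : ℝ, 0 ≤ c ∧ ∀ x, ‖(DW1 k) x‖ ≤ c * Z x ^ (1 - δ)) ∧
      (∀ δ : ℝ, 0 < δ → ∃ c : ℝ, 0 ≤ c ∧ ∀ x, ‖(D2W1 k) x‖ ≤ c * Z x ^ (1 - δ)))
    {Z11 W11 : Fin N → Fin N → EuclideanSpace ℝ (Fin N) → ℝ}
    {DZ11 DW11 : Fin N → Fin N → EuclideanSpace ℝ (Fin N) → EuclideanSpace ℝ (Fin N) →L[ℝ] ℝ}
    {D2Z11 D2W11 : Fin N → Fin N → EuclideanSpace ℝ (Fin N) →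
      EuclideanSpace ℝ (Fin N) →L[ℝ] EuclideanSpace ℝ (Fin N) →L[ℝ] ℝ}
    (pZ11 : ∀ k j, (∀ x, HasFDerivAt (Z11 k j) ((DZ11 k j) x) x) ∧ (∀ x, HasFDerivAt (DZ11 k j) ((D2Z11 k j) x) x) ∧
      (∀ δ : ℝ, 0 < δ → ∃ c : ℝ, 0 ≤ c ∧ ∀ x, |(Z11 k j) x| ≤ c * Z x ^ (1 - δ)) ∧
      (∀ δ : ℝ, 0 < δ → ∃ c : ℝ, 0 ≤ c ∧ ∀ x, ‖(DZ11 k j) x‖ ≤ c * Z x ^ (1 - δ)) ∧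
      (∀ δ : ℝ, 0 < δ → ∃ c : ℝ, 0 ≤ c ∧ ∀ x, ‖(D2Z11 k j) x‖ ≤ c * Z x ^ (1 - δ)))
    (pW11 : ∀ k j, (∀ x, HasFDerivAt (W11 k j) ((DW11 k j) x) x) ∧ (∀ x, HasFDerivAt (DW11 k j) ((D2W11 k j) x) x) ∧
      (∀ δ : ℝ, 0 < δ → ∃ c : ℝ, 0 ≤ c ∧ ∀ x, |(W11 k j) x| ≤ c * Z x ^ (1 - δ)) ∧
      (∀ δ : ℝ, 0 < δ → ∃ c : ℝ, 0 ≤ c ∧ ∀ x, ‖(DW11 k j) x‖ ≤ c * Z x ^ (1 - δ)) ∧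
      (∀ δ : ℝ, 0 < δ → ∃ c : ℝ, 0 ≤ c ∧ ∀ x, ‖(D2W11 k j) x‖ ≤ c * Z x ^ (1 - δ)))
    (hZ11 : ∀ k j x, DZ1 k x (EuclideanSpace.single j 1) = Z11 k j x)
    (hW11 : ∀ k j x, DW1 k x (EuclideanSpace.single j 1) = W11 k j x)
    (hZ1 : ∀ k x, DZ x (EuclideanSpace.single k 1) = Z1 k x)
    (hW1 : ∀ k x, DW x (EuclideanSpace.single k 1) = W1 k x)
    (hZ2 : ∀ i j x, D2Z x (EuclideanSpace.single i 1) (EuclideanSpace.single j 1) =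
      DZ1 j x (EuclideanSpace.single i 1))
    (hW2 : ∀ i j x, D2W x (EuclideanSpace.single i 1) (EuclideanSpace.single j 1) =
      DW1 j x (EuclideanSpace.single i 1))
    (hZ2s : ∀ i j x, DZ1 j x (EuclideanSpace.single i 1) = DZ1 i x (EuclideanSpace.single j 1))
    (hW2s : ∀ i j x, DW1 j x (EuclideanSpace.single i 1) = DW1 i x (EuclideanSpace.single j 1))
    {a : ℝ} (ha : 0 < a) (haW : ∀ x, a * Z x ≤ W x)
    {C Cdd : Matrix (Fin N) (Fin N) ℝ} (hC : C.PosSemidef) (hCs : ∀ i j, C j i = C i j) {lam : ℝ}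
    (u : EuclideanSpace ℝ (Fin N) → ℝ) (hu : ∀ x, u x = W x * (Z x)⁻¹)
    (g : Fin N → EuclideanSpace ℝ (Fin N) → ℝ)
    (hg : ∀ k x, g k x = W1 k x * (Z x)⁻¹ - W x * (Z x)⁻¹ * (Z1 k x * (Z x)⁻¹))
    (A : EuclideanSpace ℝ (Fin N) → ℝ) (hA : ∀ x, A x = ∑ k, ∑ l, C k l * (g k x * g l x))
    (H : EuclideanSpace ℝ (Fin N) → ℝ) (hH : ∀ x, H x = (1 / 4) * (A x * (u x)⁻¹))
    (Zd Wd : EuclideanSpace ℝ (Fin N) → ℝ) (Z1d W1d : Fin N → EuclideanSpace ℝ (Fin N) → ℝ)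
    (hZd : ∀ x, Zd x = (1 / 2) * ∑ i, ∑ j, C i j * DZ1 j x (EuclideanSpace.single i 1))
    (hWd : ∀ x, Wd x = (1 / 2) * ∑ i, ∑ j, C i j * DW1 j x (EuclideanSpace.single i 1))
    (hZ1d : ∀ k x, Z1d k x = (1 / 2) * ∑ i, ∑ j, C i j *
      D2Z1 k x (EuclideanSpace.single i 1) (EuclideanSpace.single j 1))
    (hW1d : ∀ k x, W1d k x = (1 / 2) * ∑ i, ∑ j, C i j *
      D2W1 k x (EuclideanSpace.single i 1) (EuclideanSpace.single j 1))
    (ud : EuclideanSpace ℝ (Fin N) → ℝ) (hud : ∀ x, ud x = Wd x / Z x - W x * Zd x / Z x ^ 2)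
    (gd : Fin N → EuclideanSpace ℝ (Fin N) → ℝ)
    (hgd : ∀ k x, gd k x = W1d k x / Z x - W1 k x * Zd x / Z x ^ 2 - Wd x * Z1 k x / Z x ^ 2
      - W x * Z1d k x / Z x ^ 2 + 2 * W x * Z1 k x * Zd x / Z x ^ 3)
    (Ad : EuclideanSpace ℝ (Fin N) → ℝ)
    (hAd : ∀ x, Ad x = 2 * (∑ k, ∑ l, C k l * (gd k x * g l x)) + ∑ k, ∑ l, Cdd k l * (g k x * g l x))
    (Hd : EuclideanSpace ℝ (Fin N) → ℝ)
    (hHd : ∀ x, Hd x = Ad x / (4 * u x) - A x * ud x / (4 * u x ^ 2))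
    (hms : ∀ x, lam * ((fun k => g k x) ⬝ᵥ (C *ᵥ fun k => g k x)) ≤
      (C *ᵥ fun k => g k x) ⬝ᵥ
          ((Matrix.of fun i k => -(DZ1 i x (EuclideanSpace.single k 1)) / Z x +
              Z1 i x * Z1 k x / Z x ^ 2) *ᵥ (C *ᵥ fun k => g k x)) -
        (1 / 2) * ((fun k => g k x) ⬝ᵥ (Cdd *ᵥ fun k => g k x))) :
    ∃ (DH : EuclideanSpace ℝ (Fin N) → EuclideanSpace ℝ (Fin N) →L[ℝ] ℝ)
      (D2H : EuclideanSpace ℝ (Fin N) → EuclideanSpace ℝ (Fin N) →L[ℝ] EuclideanSpace ℝ (Fin N) →L[ℝ] ℝ),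
      ((∀ x, HasFDerivAt H (DH x) x) ∧ (∀ x, HasFDerivAt DH (D2H x) x) ∧
        (∀ δ : ℝ, 0 < δ → ∃ c : ℝ, 0 ≤ c ∧ ∀ x, |H x| ≤ c * Z x ^ (-δ)) ∧
        (∀ δ : ℝ, 0 < δ → ∃ c : ℝ, 0 ≤ c ∧ ∀ x, ‖DH x‖ ≤ c * Z x ^ (-δ)) ∧
        (∀ δ : ℝ, 0 < δ → ∃ c : ℝ, 0 ≤ c ∧ ∀ x, ‖D2H x‖ ≤ c * Z x ^ (-δ))) ∧
      (∀ j, ∃ (Hj : EuclideanSpace ℝ (Fin N) → ℝ) (Hj1 : EuclideanSpace ℝ (Fin N) → EuclideanSpace ℝ (Fin N) →L[ℝ] ℝ)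
          (Hj2 : EuclideanSpace ℝ (Fin N) → EuclideanSpace ℝ (Fin N) →L[ℝ] EuclideanSpace ℝ (Fin N) →L[ℝ] ℝ),
          ((∀ x, HasFDerivAt Hj (Hj1 x) x) ∧ (∀ x, HasFDerivAt Hj1 (Hj2 x) x) ∧
            (∀ δ : ℝ, 0 < δ → ∃ c : ℝ, 0 ≤ c ∧ ∀ x, |Hj x| ≤ c * Z x ^ (-δ)) ∧
            (∀ δ : ℝ, 0 < δ → ∃ c : ℝ, 0 ≤ c ∧ ∀ x, ‖Hj1 x‖ ≤ c * Z x ^ (-δ)) ∧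
            (∀ δ : ℝ, 0 < δ → ∃ c : ℝ, 0 ≤ c ∧ ∀ x, ‖Hj2 x‖ ≤ c * Z x ^ (-δ))) ∧
          ∀ x, DH x (EuclideanSpace.single j 1) = Hj x) ∧
      ∀ x, 2 * lam * H x ≤
        ((1 / 2) * (∑ i, ∑ j, C i j * D2H x (EuclideanSpace.single i 1) (EuclideanSpace.single j 1)) -
          ∑ i, ∑ j, C i j * ((-Z1 i x / Z x) * DH x (EuclideanSpace.single j 1))) - Hd x := by
  obtain ⟨Du, D2u, pu, hDu, hD2u⟩ := quotient_tjets hZ pZ pW u hu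
  have hgk := fun k => gradQuotient_tjets hZ pZ pW (pZ1 k) (pW1 k) (g k) (hg k)
  choose Dg D2g pg hDg hD2g using hgk
  obtain ⟨DA, D2A, pA, hDA, hD2A⟩ := quadForm_tjets hZ pg C A hA
  have hau : ∀ x, a ≤ u x := fun x => by
    rw [hu, ← div_eq_mul_inv, le_div_iff₀ (hZ x)]
    exact haW x
  obtain ⟨DH, D2H, pH, hDH, hD2H⟩ := sqrtEnergy_tjets hZ hZK pu pA ha hau H hH
  have hgDu' : ∀ k x, Du x (EuclideanSpace.single k 1) = g k x := fun k x => by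
    have hZx : Z x ≠ 0 := (hZ x).ne'
    rw [hDu, hZ1, hW1, hg]
    field_simp
  refine ⟨DH, D2H, pH, fun j => ?_, fun x => ?_⟩
  · ---------------------------------------------------------------- the tame pack of `∂_j H`
    have hZp : (∀ x, HasFDerivAt Z (DZ x) x) ∧ (∀ x, HasFDerivAt DZ (D2Z x) x) ∧
        (∀ δ : ℝ, 0 < δ → ∃ c : ℝ, 0 ≤ c ∧ ∀ x, ‖DZ x‖ ≤ c * Z x ^ (1 - δ)) ∧
        (∀ δ : ℝ, 0 < δ → ∃ c : ℝ, 0 ≤ c ∧ ∀ x, ‖D2Z x‖ ≤ c * Z x ^ (1 - δ)) :=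
      ⟨pZ.1, pZ.2.1, pZ.2.2.2.1, pZ.2.2.2.2⟩
    have qW := tpack_of_jpack_div hZ hZp pW
    have qW1 := fun k => tpack_of_jpack_div hZ hZp (pW1 k)
    have qZ1 := fun k => tpack_of_jpack_div hZ hZp (pZ1 k)
    have qW11 := fun k => tpack_of_jpack_div hZ hZp (pW11 k j)
    have qZ11 := fun k => tpack_of_jpack_div hZ hZp (pZ11 k j)
    -- `M_l = ∂_j g_l`
    have pM := fun l => tpack_add
      (tpack_sub (tpack_sub (tpack_sub (qW11 l) (tpack_mul hZ (qW1 l) (qZ1 j)))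
        (tpack_mul hZ (qW1 j) (qZ1 l))) (tpack_mul hZ qW (qZ11 l)))
      (tpack_const_mul (2 : ℝ) (tpack_mul hZ (tpack_mul hZ qW (qZ1 l)) (qZ1 j)))
    have hM : ∀ l x, Dg l x (EuclideanSpace.single j 1) =
        W11 l j x * (Z x)⁻¹ - W1 l x * (Z x)⁻¹ * (Z1 j x * (Z x)⁻¹) -
          W1 j x * (Z x)⁻¹ * (Z1 l x * (Z x)⁻¹) - W x * (Z x)⁻¹ * (Z11 l j x * (Z x)⁻¹) +
          2 * (W x * (Z x)⁻¹ * (Z1 l x * (Z x)⁻¹) * (Z1 j x * (Z x)⁻¹)) := by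
      intro l x
      have hZx : Z x ≠ 0 := (hZ x).ne'
      rw [hDg, hW11, hZ1, hW1, hZ11]
      ring
    -- `∂_j A`
    have pDAj := tpack_sum Finset.univ fun k _ => tpack_sum Finset.univ fun l _ =>
      tpack_const_mul (C k l) (tpack_add (tpack_mul hZ (pg k) (pM l)) (tpack_mul hZ (pg l) (pM k)))
    have hDAj : ∀ x, DA x (EuclideanSpace.single j 1) = ∑ k, ∑ l, C k l *
        (g k x * (W11 l j x * (Z x)⁻¹ - W1 l x * (Z x)⁻¹ * (Z1 j x * (Z x)⁻¹) -
            W1 j x * (Z x)⁻¹ * (Z1 l x * (Z x)⁻¹) - W x * (Z x)⁻¹ * (Z11 l j x * (Z x)⁻¹) +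
            2 * (W x * (Z x)⁻¹ * (Z1 l x * (Z x)⁻¹) * (Z1 j x * (Z x)⁻¹))) +
          g l x * (W11 k j x * (Z x)⁻¹ - W1 k x * (Z x)⁻¹ * (Z1 j x * (Z x)⁻¹) -
            W1 j x * (Z x)⁻¹ * (Z1 k x * (Z x)⁻¹) - W x * (Z x)⁻¹ * (Z11 k j x * (Z x)⁻¹) +
            2 * (W x * (Z x)⁻¹ * (Z1 k x * (Z x)⁻¹) * (Z1 j x * (Z x)⁻¹)))) := by
      intro x
      rw [hDA]
      simp only [hM]
    -- `∂_j H = ∂_jA/(4u) − A g_j/(4u²)`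
    have pIu := tpack_inv hZ hZK pu ha hau
    have pHj := tpack_sub (tpack_const_mul (1 / 4 : ℝ) (tpack_mul hZ pDAj pIu))
      (tpack_const_mul (1 / 4 : ℝ) (tpack_mul hZ (tpack_mul hZ pA (pg j)) (tpack_mul hZ pIu pIu)))
    refine ⟨_, _, _, pHj, fun x => ?_⟩
    rw [hDH, hgDu', hDAj]
    ring
  -- the jets at the point `x`
  have hZ : Z x ≠ 0 := (hZ x).ne'
  have hux : 0 < u x := ha.trans_le (hau x)
  have hgDu : ∀ k, Du x (EuclideanSpace.single k 1) = g k x := fun k => hgDu' k x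
  have hCT : Cᵀ = C := Matrix.ext fun i j => hCs i j
  -- `M_{jk} = ∂_k g_j`, `R_{ik} = ∂_i∂_k V_t`
  set M : Matrix (Fin N) (Fin N) ℝ := Matrix.of fun j k => Dg j x (EuclideanSpace.single k 1) with hMdef
  have hMjk : ∀ j k, M j k = DW1 j x (EuclideanSpace.single k 1) / Z x - W1 j x * Z1 k x / Z x ^ 2
      - W1 k x * Z1 j x / Z x ^ 2 - W x * DZ1 j x (EuclideanSpace.single k 1) / Z x ^ 2
      + 2 * W x * Z1 j x * Z1 k x / Z x ^ 3 := by
    intro j k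
    simp only [hMdef, Matrix.of_apply]
    rw [hDg, hZ1, hW1]
  have hMT : Mᵀ = M := by
    refine Matrix.ext fun j k => ?_
    rw [Matrix.transpose_apply, hMjk, hMjk, hW2s k j x, hZ2s k j x]
    ring
  set R : Matrix (Fin N) (Fin N) ℝ := Matrix.of fun i k =>
    -(DZ1 i x (EuclideanSpace.single k 1)) / Z x + Z1 i x * Z1 k x / Z x ^ 2 with hRdef
  -- (1) `u̇ = L u` in jet form
  have h1 : ud x = (1 / 2) * (∑ i, ∑ j, C i j * M j i) -
      ∑ i, ∑ j, C i j * ((-Z1 i x / Z x) * g j x) := by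
    have h := jet_generator (n := Fin N) hCs hZ (W := W x) (Z1 := fun i => Z1 i x)
      (W1 := fun i => W1 i x) (g := fun k => g k x) (p := fun i => -Z1 i x / Z x)
      (Z2 := fun i j => DZ1 j x (EuclideanSpace.single i 1))
      (W2 := fun i j => DW1 j x (EuclideanSpace.single i 1)) (N := fun i j => M j i)
      (Zd := Zd x) (Wd := Wd x) (ud := ud x)
      (fun i j => hZ2s j i x) (fun i j => hW2s j i x)
      (fun k => by rw [hg]; ring) (fun i => rfl)
      (fun i j => hMjk j i) (hZd x) (hWd x) (hud x)
    exact h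
  -- (2) `ġ_k = ∂_k L u` in jet form
  have h2 : ∀ k, gd k x = (1 / 2) * (∑ i, ∑ j, C i j *
      D2g k x (EuclideanSpace.single i 1) (EuclideanSpace.single j 1)) -
      ∑ i, ∑ j, C i j * (R i k * g j x + (-Z1 i x / Z x) * M j k) := by
    intro k
    have h := jet_gradient_generator (n := Fin N) hCs hZ (W := W x) (Z1 := fun i => Z1 i x)
      (W1 := fun i => W1 i x) (g := fun k => g k x) (p := fun i => -Z1 i x / Z x)
      (Z1d := fun k => Z1d k x) (W1d := fun k => W1d k x) (gd := fun k => gd k x)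
      (Z2 := fun i j => DZ1 j x (EuclideanSpace.single i 1))
      (W2 := fun i j => DW1 j x (EuclideanSpace.single i 1)) (M := fun j k => M j k)
      (R := fun i k => R i k)
      (Z3 := fun i j k => D2Z1 k x (EuclideanSpace.single i 1) (EuclideanSpace.single j 1))
      (W3 := fun i j k => D2W1 k x (EuclideanSpace.single i 1) (EuclideanSpace.single j 1))
      (T := fun k i j => D2g k x (EuclideanSpace.single i 1) (EuclideanSpace.single j 1))
      (Zd := Zd x) (Wd := Wd x)
      (fun i j => hZ2s j i x) (fun i j => hW2s j i x)
      (fun k => by rw [hg]; ring) (fun i => rfl)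
      (fun j k => hMjk j k) (fun i k => rfl)
      (fun k i j => by
        rw [hD2g, hZ1, hZ1, hW1, hW1, hZ2, hW2]
        ring)
      (hZd x) (hWd x) (fun k => hZ1d k x) (fun k => hW1d k x) (fun k => hgd k x) k
    exact h
  -- (3) the Bochner inequality
  have key := bochner_sqrt_ineq (n := Fin N) hC hCT hMT hux h1 h2 (hms x)
    (Cdd := Cdd) (A := A x) (H := H x) (Hd := Hd x) (Ad := Ad x)
    (dA := fun j => DA x (EuclideanSpace.single j 1))
    (dH := fun j => DH x (EuclideanSpace.single j 1))
    (d2A := fun i j => D2A x (EuclideanSpace.single i 1) (EuclideanSpace.single j 1))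
    (d2H := fun i j => D2H x (EuclideanSpace.single i 1) (EuclideanSpace.single j 1))
    (U2 := fun i j => D2u x (EuclideanSpace.single i 1) (EuclideanSpace.single j 1))
    (hA x) (fun j => hDA x _) (fun i j => hD2A x _ _)
    (fun i j => by
      rw [hD2u, hZ1, hZ1, hW1, hW1, hZ2, hW2, hMjk]
      ring)
    (by rw [hH]; ring)
    (fun j => by rw [hDH, hgDu])
    (fun i j => by rw [hD2H, hgDu, hgDu])
    rfl (hAd x) (hHd x)
  exact key

end Jets

end Polchinski

end Literature.Analysis.FunctionSpaces

end
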